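import Mathlib
import Literature.NumberTheory.Automorphic.HilbertModularFormQExpansion

/-!
# Crux `HilbertIntegralOverconvergentIsCongruence` (stmt-Langlands-8485), line `Sketch-ideate-r1-k1`,
# section M (Koecher principle at a cusp): stub `stub_rescale` (M-A4)

Section M of the line proves the Koecher principle for Hilbert modular forms (Freitag, *Hilbert
Modular Forms*, Ch. I Prop. 4.9 Cor.).  At a cusp `g` the slashed form `h = f|_k g` is periodic only
under a non-zero ideal `𝔪` of `𝓞 F`; rescaling `z ↦ N z` with `N = Nm(𝔪) ∈ 𝔪 ∩ ℕ` makes it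
`𝓞 F`-periodic, and the boundedness theorem of section L is applied to the rescaled function.  This
file proves the registered stub `stub_rescale`, which carries holomorphy forward and boundedness at
`∞` back along the rescaling: (1) `z ↦ N z` is `ℂ`-linear, hence differentiable, and maps `ℍ` into
itself for `N > 0` (`Im (N z_σ) = N Im z_σ > 0`), so `z ↦ h(N z)` is holomorphic on `ℍ` when `h` is;
(2) if `‖h(N w)‖ ≤ C` for `w ∈ ℍ` with all `Im w_σ ≥ A`, then for `z ∈ ℍ` with all
`Im z_σ ≥ N · max(A, 0)` the point `w = N⁻¹ z` lies in `ℍ`, has `Im w_σ = Im z_σ / N ≥ A`, and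
`h z = h(N w)`, whence `‖h z‖ ≤ C`.
-/

set_option linter.dupNamespace false

noncomputable section

namespace Summit.Langlands.Langlands.Theorems.HilbertIntegralOverconvergentIsCongruence

open MeasureTheory Complex NumberField
open Literature.NumberTheory.Automorphic Literature.NumberTheory.Automorphic.HilbertModular

/-- The coordinatewise rescaling `z ↦ (c z_σ)_σ` by a complex scalar is `ℂ`-differentiable on
`ℂ^{Hom(F,ℝ)}`. -/
theorem rsc_differentiable_const_mul (F : Type) [Field F] [NumberField F] (c : ℂ) :
    Differentiable ℂ fun z : Point F ↦ fun σ ↦ c * z σ :=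
  differentiable_pi.2 fun σ ↦ (differentiable_apply σ).const_mul c

/-- Imaginary part of a coordinate rescaled by a natural number: `Im (N w) = N Im w`. -/
theorem rsc_im_natCast_mul (N : ℕ) (w : ℂ) : ((N : ℂ) * w).im = (N : ℝ) * w.im := by
  rw [← Complex.ofReal_natCast, Complex.im_ofReal_mul]

/-- For `N > 0` the rescaling `z ↦ N z` maps the half space `ℍ` into itself. -/
theorem rsc_mapsTo_halfSpace (F : Type) [Field F] [NumberField F] (N : ℕ) (hN : 0 < N) :
    Set.MapsTo (fun z : Point F ↦ fun σ ↦ (N : ℂ) * z σ) (halfSpace F) (halfSpace F) := by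
  intro z hz σ
  show 0 < ((N : ℂ) * z σ).im
  rw [rsc_im_natCast_mul]
  exact mul_pos (Nat.cast_pos.2 hN) (hz σ)

/-- For `N > 0` and `z ∈ ℍ` the rescaled point `N⁻¹ z` lies in `ℍ`, and its heights are at least `A`
as soon as the heights of `z` are at least `N · max(A, 0)`. -/
theorem rsc_inv_mul_mem_halfSpace (F : Type) [Field F] [NumberField F] (N : ℕ) (hN : 0 < N)
    (A : ℝ) {z : Point F} (hz : z ∈ halfSpace F) (hA : ∀ σ, (N : ℝ) * max A 0 ≤ (z σ).im) :
    (fun σ ↦ (((N : ℝ)⁻¹ : ℝ) : ℂ) * z σ) ∈ halfSpace F ∧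
      ∀ σ, A ≤ ((((N : ℝ)⁻¹ : ℝ) : ℂ) * z σ).im := by
  have hNpos : (0 : ℝ) < N := Nat.cast_pos.2 hN
  refine ⟨fun σ ↦ ?_, fun σ ↦ ?_⟩
  · show 0 < ((((N : ℝ)⁻¹ : ℝ) : ℂ) * z σ).im
    rw [Complex.im_ofReal_mul]
    exact mul_pos (inv_pos.2 hNpos) (hz σ)
  · rw [Complex.im_ofReal_mul]
    calc A ≤ max A 0 := le_max_left _ _
      _ = (N : ℝ)⁻¹ * ((N : ℝ) * max A 0) := by rw [inv_mul_cancel_left₀ hNpos.ne']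
      _ ≤ (N : ℝ)⁻¹ * (z σ).im := mul_le_mul_of_nonneg_left (hA σ) (inv_pos.2 hNpos).le

/-- **stub M-A4 — `stub_rescale`.** Rescaling `z ↦ N z` (`N ≥ 1`) on the tube domain: holomorphy
on `ℍ` passes from `h` to `z ↦ h(N z)`, and boundedness at `∞` passes back from `z ↦ h(N z)` to `h`
(Freitag, *Hilbert Modular Forms*, Ch. I, proof of Prop. 4.9 Cor.: reduction of the translation
lattice at a cusp to `𝓞 F`). [folklore] -/
theorem stub_rescale (F : Type) [Field F] [NumberField F] (h : Point F → ℂ) (N : ℕ) (hN : 0 < N) :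
    (IsHolomorphicOn F h → IsHolomorphicOn F (fun z ↦ h (fun σ ↦ (N : ℂ) * z σ))) ∧
    (IsBoundedAtInfty F (fun z ↦ h (fun σ ↦ (N : ℂ) * z σ)) → IsBoundedAtInfty F h) := by
  refine ⟨fun hh ↦ ?_, fun hb ↦ ?_⟩
  · exact hh.comp (rsc_differentiable_const_mul F (N : ℂ)).differentiableOn
      (rsc_mapsTo_halfSpace F N hN)
  · obtain ⟨C, A, hCA⟩ := hb
    have hN0 : (N : ℂ) ≠ 0 := Nat.cast_ne_zero.2 hN.ne'
    refine ⟨C, (N : ℝ) * max A 0, fun z hz hA ↦ ?_⟩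
    obtain ⟨hw, hwA⟩ := rsc_inv_mul_mem_halfSpace F N hN A hz hA
    have key := hCA _ hw hwA
    have hzw : (fun σ ↦ (N : ℂ) * ((((N : ℝ)⁻¹ : ℝ) : ℂ) * z σ)) = z := funext fun σ ↦ by
      rw [Complex.ofReal_inv, Complex.ofReal_natCast, mul_inv_cancel_left₀ hN0]
    simpa only [hzw] using key

end Summit.Langlands.Langlands.Theorems.HilbertIntegralOverconvergentIsCongruence
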